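import Literature.AnabelianGeometry.EtaleTheta.SettingModelChiTwistedLatticeCoverings
import Literature.AnabelianGeometry.AbsoluteAnabelian.ZHatCompletionAdicCompleteness
import HarnessLib

/-!
# The χ-twisted root model with an extra Tate lattice, file 1c: the theta kernel and the root record `ThetaSetting.modelLat`
# (F-2633 closure certificate «F2633-SWAP-TOWER»)

Mochizuki, *The étale theta function …*, Publ. RIMS **45** (2009) [EtTh], §1, PRIMS PDF pp. 11–15, 17
[cite: MochizukiEtTh2009, §1 p.12] ("`Π^tp_X ↠ (Π^tp_X)^Θ ↠ (Π^tp_X)^ell` … induced by the quotients `Δ_X ↠ Δ^Θ_X ↠ Δ^ell_X`";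
p. 14 "`Z_N` … `(Π^tp_{Y_N})^Θ`").

LATTICE TWIST OF `Ẑ(1)²` — NOT the (B) section twist (cf. file 1 and abc-iut-L2-lead R709).  abc-iut cell, K-L6 slice, row
«KL6-CLOSURE-CERT F-2633», seat abc-iut-L6-t19 (gen 8).  Over files 1/1b (`curveLat`, `YNLat`, `ZNLat`, `toZLat`):
* `left_snd_eq_one_of_mem_thetaKer`: the theta kernel `toHat⁻¹([[Δ_X,Δ_X],Δ_X]⁻)` of `curveLat` (abc-iut-L2-d1's GENERIC
  `CurveTheta.thetaKer`) has TRIVIAL lattice coordinate — `Δ_X ≤ Ker(Π_X ↠ G_{ℚ_p})`, commutators of such elements have lattice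
  coordinate `1` (the lattice `Ẑ(1)²` is abelian, `ZHatCompletion.mul_comm`), and `{σ = 1, t = 1}` is a closed subgroup — whence
  `thetaKer_inf_YNLat_le_ZNLat` (`Ker(Π^tp_X ↠ (Π^tp_X)^Θ) ∩ Π□_{Y_N} ≤ Π□_{Z_N}`: `ℓ_N(t₂) = ℓ_N(1) = 0`);
* the `Normal` instances of the generic kernels re-exported at the concrete carrier (cf. `SettingModelChiLevelKernels`);
* **`ThetaSetting.modelLat p : ThetaSetting p`** — theta quotients := `CurveTheta.*` of `curveLat` (all kernel / commutativity /
  centrality clauses generic), `q_X := p²`, `K := ℚ_p` (as `modelχ`), `toZ := toZLat`, `Y_N := YNLat`, `Z_N := ZNLat`.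

HONEST LABEL: semi-synthetic model (consistency/independence evidence for OUR typed interface only); not the tempered
fundamental group of a curve; nothing of [EtTh] asserted; decides (H1)/F-2633 at no genuine instance; no side taken on
[IUTchIII] Cor. 3.12.  Class (b) construction file (def-bearing; instances only on kernels of the NEW carrier; no notation;
no Prop-valued def).
-/

noncomputable section

namespace Literature.AnabelianGeometry.EtaleTheta.SettingModel

open Literature.AnabelianGeometry.SemiGraphs _root_.Topology _root_.Function
open scoped commutatorElement

variable (p : ℕ) [Fact p.Prime]

/-! ### The theta kernel has trivial lattice coordinate -/

/-- `x ↦ ((x, 1), 1)`: `F̂₂` as a subgroup of `Π_X` with trivial lattice and Galois coordinates. [cite: MochizukiEtTh2009, §1 p.12] -/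
def inlHatF : F₂hatT →* PiHtLat p :=
  (SemidirectProduct.inl : GfpLatHat →* PiHtLat p).comp (MonoidHom.inl F₂hatT Latt)

/-- [cite: MochizukiEtTh2009, §1 p.12] -/
theorem inlHatF_apply (x : F₂hatT) : inlHatF p x = SemidirectProduct.inl (x, 1) := rfl

/-- Membership in the range of `inlHatF`: trivial Galois coordinate and trivial lattice coordinate.
[cite: MochizukiEtTh2009, §1 p.12] -/
theorem mem_range_inlHatF_iff (h : PiHtLat p) : h ∈ (inlHatF p).range ↔ h.right = 1 ∧ h.left.2 = 1 := by
  constructor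
  · rintro ⟨x, rfl⟩
    exact ⟨rfl, rfl⟩
  · rintro ⟨h1, h2⟩
    refine ⟨h.left.1, ?_⟩
    rw [inlHatF_apply]
    have e : (h.left.1, (1 : Latt)) = h.left := Prod.ext rfl h2.symm
    rw [e, ← SemidirectProduct.inl_left_mul_inr_right h, h1, map_one, mul_one, SemidirectProduct.left_inl]

/-- The range of `inlHatF` is closed. [cite: MochizukiEtTh2009, §1 p.12] -/
theorem isClosed_range_inlHatF : IsClosed ((inlHatF p).range : Set (PiHtLat p)) := by
  haveI : T2Space (GQp p) := krullTopology_t2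
  have e : ((inlHatF p).range : Set (PiHtLat p)) =
      (fun h : PiHtLat p => h.right) ⁻¹' {1} ∩ (fun h : PiHtLat p => h.left.2) ⁻¹' {1} := by
    ext h
    exact mem_range_inlHatF_iff p h
  rw [e]
  exact (isClosed_singleton.preimage (Semidirect.continuous_right (isInducing_leftRightHatLat p))).inter
    (isClosed_singleton.preimage (continuous_snd.comp (Semidirect.continuous_left (isInducing_leftRightHatLat p))))

/-- `Δ_X ≤ Ker(Π_X ↠ G_{ℚ_p})`. [cite: MochizukiEtTh2009, §1 p.12] -/
theorem deltaHatLat_le_ker_rightHom :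
    (curveLat p).DeltaHat ≤ (SemidirectProduct.rightHom : PiHtLat p →* GQp p).ker := by
  haveI : T2Space (GQp p) := krullTopology_t2
  have hcl : IsClosed ((SemidirectProduct.rightHom : PiHtLat p →* GQp p).ker : Set (PiHtLat p)) := by
    have e : ((SemidirectProduct.rightHom : PiHtLat p →* GQp p).ker : Set (PiHtLat p)) =
        (fun g : PiHtLat p => g.right) ⁻¹' {1} := by
      ext g; simp [MonoidHom.mem_ker, SemidirectProduct.rightHom]
    rw [e]
    exact isClosed_singleton.preimage (Semidirect.continuous_right (isInducing_leftRightHatLat p))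
  refine Subgroup.topologicalClosure_minimal _ ?_ hcl
  rintro _ ⟨g, hg, rfl⟩
  rw [MonoidHom.mem_ker]
  change ((curveLat p).toHat g).right = 1
  exact (mem_deltaTempLat_iff p g).mp hg

/-- Commutators of elements with trivial Galois coordinate have trivial lattice coordinate (the lattice is abelian).
[cite: MochizukiEtTh2009, §1 p.12] -/
theorem commutatorElement_mem_range_inlHatF {a b : PiHtLat p} (ha : a.right = 1) (hb : b.right = 1) :
    ⁅a, b⁆ ∈ (inlHatF p).range := by
  have ea : a = SemidirectProduct.inl a.left := by
    rw [← SemidirectProduct.inl_left_mul_inr_right a, ha, map_one, mul_one, SemidirectProduct.left_inl]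
  have eb : b = SemidirectProduct.inl b.left := by
    rw [← SemidirectProduct.inl_left_mul_inr_right b, hb, map_one, mul_one, SemidirectProduct.left_inl]
  rw [mem_range_inlHatF_iff, ea, eb, ← map_commutatorElement, SemidirectProduct.right_inl,
    SemidirectProduct.left_inl]
  refine ⟨rfl, ?_⟩
  show ⁅a.left, b.left⁆.2 = 1
  rw [commutatorElement_def]
  show a.left.2 * b.left.2 * a.left.2⁻¹ * b.left.2⁻¹ = 1
  have hc : a.left.2 * b.left.2 = b.left.2 * a.left.2 :=
    Prod.ext (Literature.AnabelianGeometry.AbsoluteAnabelian.ZHatCompletion.mul_comm _ _)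
      (Literature.AnabelianGeometry.AbsoluteAnabelian.ZHatCompletion.mul_comm _ _)
  rw [hc, mul_inv_cancel_right, mul_inv_cancel]

/-- `[[Δ_X, Δ_X], Δ_X]⁻ ≤ range(inlHatF)`: the closed commutator subgroups of `Δ_X` have trivial lattice coordinate.
[cite: MochizukiEtTh2009, §1 p.12] -/
theorem closure_commutator₃_le_range_inlHatF :
    (⁅⁅(curveLat p).DeltaHat, (curveLat p).DeltaHat⁆, (curveLat p).DeltaHat⁆).topologicalClosure ≤ (inlHatF p).range := by
  refine Subgroup.topologicalClosure_minimal _ ?_ (isClosed_range_inlHatF p)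
  have hR := deltaHatLat_le_ker_rightHom p
  have h1 : ⁅(curveLat p).DeltaHat, (curveLat p).DeltaHat⁆ ≤ (inlHatF p).range := by
    rw [Subgroup.commutator_le]
    intro a ha b hb
    exact commutatorElement_mem_range_inlHatF p (hR ha) (hR hb)
  rw [Subgroup.commutator_le]
  intro c hc d hd
  have hc' := (mem_range_inlHatF_iff p c).mp (h1 hc)
  exact commutatorElement_mem_range_inlHatF p hc'.1 (hR hd)

/-- **The theta kernel of `curveLat` has trivial lattice coordinate.** [cite: MochizukiEtTh2009, §1 p.14] -/
theorem left_snd_eq_one_of_mem_thetaKer {g : PiTpLat p} (hg : g ∈ CurveTheta.thetaKer (curveLat p)) : g.left.2 = 1 := by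
  have hmem : toHatLat p g ∈
      (⁅⁅(curveLat p).DeltaHat, (curveLat p).DeltaHat⁆, (curveLat p).DeltaHat⁆).topologicalClosure := hg
  have h := ((mem_range_inlHatF_iff p _).mp (closure_commutator₃_le_range_inlHatF p hmem)).2
  rw [toHatLat_left, gfpLatFst_apply] at h
  exact h

/-- **`Ker(Π^tp_X ↠ (Π^tp_X)^Θ) ∩ Π□^tp_{Y_N} ≤ Π□^tp_{Z_N}`**. [cite: MochizukiEtTh2009, §1 p.14] -/
theorem thetaKer_inf_YNLat_le_ZNLat (N : ℕ+) : CurveTheta.thetaKer (curveLat p) ⊓ YNLat p N ≤ ZNLat p N := by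
  intro g hg
  obtain ⟨hT, hY⟩ := Subgroup.mem_inf.mp hg
  have hright : g.right = 1 := (mem_deltaTempLat_iff p g).mp (CurveTheta.thetaKer_le_deltaTemp (curveLat p) hT)
  rw [mem_ZNLat_iff, mem_AZLat_iff]
  refine ⟨⟨((mem_YNLat_iff p).mp hY).1, ?_⟩, by rw [hright]; exact Subgroup.one_mem _⟩
  rw [lattLevel₂_apply, left_snd_eq_one_of_mem_thetaKer p hT]
  exact map_one _

/-! ### The root record -/

/-- `Ker(Π^tp_X ↠ (Π^tp_X)^Θ) ⊴ Π^tp_X` at the lattice model — abc-iut-L2-d1's generic `CurveTheta.thetaKer_normal`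
re-exported at the concrete carrier (instance retrieval, cf. `SettingModelChiLevelKernels.thetaKerχ_normal`).
[cite: MochizukiEtTh2009, §1 p.12] -/
instance thetaKerLat_normal : (CurveTheta.thetaKer (curveLat p)).Normal := CurveTheta.thetaKer_normal _

/-- `Ker(Π^tp_X ↠ (Π^tp_X)^ell) ⊴ Π^tp_X` at the lattice model (same re-export). [cite: MochizukiEtTh2009, §1 p.12] -/
instance ellKerLat_normal : (CurveTheta.ellKer (curveLat p)).Normal := CurveTheta.ellKer_normal _

/-- **The lattice-twisted model of the [EtTh] §1 root** (`Π^tp_X := (Γ × Ẑ(1)²) ⋊_χ G_{ℚ_p}`, `K := ℚ_p`, `q_X := p²`,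
theta quotients generic, `Y_N`/`Z_N` fibred with the indices on the lattice). SEMI-SYNTHETIC (not the tempered `π₁` of a
curve). [cite: MochizukiEtTh2009, §1 p.11] -/
abbrev _root_.Literature.AnabelianGeometry.EtaleTheta.ThetaSetting.modelLat : ThetaSetting p where
  toTemperedCurve := curveLat p
  qX := qModel p
  qX_mem := qModel_mem_botχ p
  norm_qX_lt_one := (ThetaSetting.modelχ p).norm_qX_lt_one
  qX_ne_zero := qModel_ne_zeroχ p
  sqrtqX := ((p : ℕ) : PadicAlgCl p)
  sqrtqX_sq := (ThetaSetting.modelχ p).sqrtqX_sq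
  toZ := toZLat p
  toZ_surjective := Semidirect.leftHom_surjective degLat (degLat_actLat p) degLat_surjective
  isOpen_ker_toZ := isOpen_ker_toZLat p
  toZ_delta_surjective := Semidirect.leftHom_restrict_ker_rightHom_surjective degLat (degLat_actLat p) degLat_surjective
  GtpTheta := CurveTheta.GTheta (curveLat p)
  toTheta := CurveTheta.toTheta (curveLat p)
  continuous_toTheta := CurveTheta.continuous_toTheta (curveLat p)
  toTheta_surjective := CurveTheta.toTheta_surjective (curveLat p)
  ker_toTheta := CurveTheta.ker_toTheta (curveLat p)
  GtpEll := CurveTheta.GEll (curveLat p)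
  thetaToEll := CurveTheta.thetaToEll (curveLat p)
  continuous_thetaToEll := CurveTheta.continuous_thetaToEll (curveLat p)
  thetaToEll_surjective := CurveTheta.thetaToEll_surjective (curveLat p)
  ker_toEll := CurveTheta.ker_toEll (curveLat p)
  ker_thetaToEll_comm := CurveTheta.ker_thetaToEll_comm (curveLat p)
  ker_thetaToEll_central := CurveTheta.ker_thetaToEll_central (curveLat p)
  GtpYN := YNLat p
  GtpYN_one := YNLat_one p
  GtpYN_le := YNLat_le p
  map_aug_GtpYN N := map_rightHom_YNLat p N
  GtpYN_normal := YNLat_normal p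
  isOpen_GtpYN N := isOpen_YNLat p N
  GtpYN_anti M N h := YNLat_anti p h
  relIndex_deltaYN N := relIndex_YNLat p N
  GtpZN := ZNLat p
  GtpZN_le := ZNLat_le_YNLat p
  map_aug_GtpZN N := map_rightHom_ZNLat p N
  GtpZN_normal := ZNLat_normal p
  isOpen_GtpZN N := isOpen_ZNLat p N
  GtpZN_anti M N h := ZNLat_anti p h
  relIndex_deltaZN N := relIndex_ZNLat p N
  ker_toTheta_le_GtpZN N := by
    rw [CurveTheta.ker_toTheta]
    exact thetaKer_inf_YNLat_le_ZNLat p N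

end Literature.AnabelianGeometry.EtaleTheta.SettingModel

end
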